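import Mathlib
import HarnessLib
import Summits.HubbardSuperconductivity.HubbardSuperconductivity.Theorems.KLProgrammeKLRegimeEnginePairTransferPinnedStep
import Summits.HubbardSuperconductivity.HubbardSuperconductivity.Theorems.KLProgrammeKLRegimeSplitEdgeFactsSliceLines

/-!
# Route `KLProgramme` — ENGINE child gen 8 (stmt-HubbardSuperconductivity-20437 `KLRegimeEngineV17F2`), skeleton v2 class #5 «(S)-transfer», stub (c):
# the producer door with the MODEL WEIGHTS — `pairTransferPinnedAt_succ_model` (cell gate-hubbard-kl, seat hubbard-kl-p1 g12; plan g20 (R54e) «MODEL PACKAGE» GO)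

WHY.  `pairTransferPinnedAt_succ` (p581707) takes, per pair class, five weight-dependent side conditions — `(m+e)·Σ|w+b′| ≤ 1/3`, `((3/2)m+e₁)·Σ|w₁| ≤ 1/3`,
`m·Σ|b′+w−w₁| ≤ 1/3`, `m·Σ|t| ≤ 1/3` and the slack `Σ|(b′+w−w₁) − t| ≤ δ`.  When the (c) closer runs the plain step with `w := klSliceWeightPlain … (K_{n+1}) (n+1) Qm` and the
member tower with `w₁ := klSliceWeightSmeared … (K_{n+1}) (n+1) φ Qm` (the weights of the conservation identity `klTransferWeight_succ`), the model lines of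
`…SplitEdgeFactsSliceLines` (p581438: `Σ|w|, Σ|w₁| ≤ 2^18`) and `…SplitEdgeFactsTransferLines` (p580182: `Σ|t| ≤ 2^16`) turn the four smallness conditions into ONE numeric
door `((3/2)m + e + e₁)·2^20 ≤ 1/3` (given any history weight of mass `Σ|b′| ≤ 2^16`, e.g. the pinned history weight at the history's frame), and the slack collapses to the FRAME
SLACK of the history weight alone: `δ := Σ_p |b′ p − klTransferWeight … (K_{n+1}) n (φ + s_{n+1}) Qm p|` (`= 0` if the history is stated at the new frame).
* §1 `klModelWeights_masses` / **`klModelWeights_smallness`** — the four conjuncts from `FrameOK R U N μ (K_{n+1})`, `klBetaMin ≤ β ≤ L`, `φ` admissible at `(K_{n+1}, n+1)`,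
  `Σ|b′| ≤ 2^16`, `0 ≤ m, e, e₁`, `((3/2)m + e + e₁)·2^20 ≤ 1/3`; `klModelWeights_slack_le` (the slack is the frame slack).
* §2 **`pairTransferPinnedAt_succ_model`** — the door with `w, w₁` THE MODEL WEIGHTS: per pair class the caller supplies `X, Y, N₀, M′, N`, the history weight `b′` with
  `Σ|b′| ≤ 2^16`, the three relations with `E ≤ e`, `R′`, `E_a`, the intermediate majorant `E₁ ≤ e₁`, the numeric door, and the budget
  `E_a + FT_{|w₁|}(E₁) + (9/4)m²·Σ|b′ − t_n[φ + s_{n+1}]| ≤ transferBarAt … (n+1) Qm` ⟹ `PairTransferPinnedAt L M G P r β U μ (n+1) φ`.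
Bookkeeping over landed lemmas; nothing about the model's sizes is asserted beyond the landed lines; nothing asserts superconductivity.  0 kit.
-/

noncomputable section

namespace Summit.HubbardSuperconductivity.HubbardSuperconductivity.Theorems.KLRegimeSplit

set_option linter.dupNamespace false -- summit = problem name (single-conjunct summit), D-0017

open Finset Matrix Literature.MathematicalPhysics.QuantumLattice Literature.Probability.LatticeModels
open Summit.HubbardSuperconductivity.HubbardSuperconductivity.Theorems.KLProgrammeLegKernels
open Summit.HubbardSuperconductivity.HubbardSuperconductivity.Theorems.TwoPointAssembly

/-! ## §1 The model weights' masses, the four smallness conjuncts, the slack -/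

section Smallness

variable {L M : ℕ} [NeZero L] {R : RenConsts} {U : ℝ} {N : ℕ} {β μ : ℝ} {K : TrigPolyC4v} {n : ℕ} {φ : FreqMomentum L M → ℝ}

/-- **The masses of the three model weights and of their composite** at one frame `K` (scale `n+1`, member `φ`): `Σ|w| ≤ 2^18`, `Σ|w₁| ≤ 2^18`, `Σ|t| ≤ 2^16`, and for any
history weight with `Σ|b′| ≤ 2^16`: `Σ|w + b′| ≤ 2^18 + 2^16`, `Σ|b′ + w − w₁| ≤ 2^16 + 2^19`. -/
theorem klModelWeights_masses (hK : FrameOK R U N μ K) (hβ : klBetaMin ≤ β) (hβL : β ≤ L)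
    (hφ : ∀ k, 0 ≤ φ k ∧ φ k ≤ 1 - hubbardCutoffWeightCT L M β μ K (klScale klE0 (n + 1)) k) (Qm : TorusSite 2 L)
    {b' : TorusSite 2 L → ℝ} (hb' : ∑ p, |b' p| ≤ 2 ^ 16) :
    ∑ p, |klSliceWeightPlain L M β μ K (n + 1) Qm p + b' p| ≤ 2 ^ 18 + 2 ^ 16 ∧
      ∑ p, |klSliceWeightSmeared L M β μ K (n + 1) φ Qm p| ≤ 2 ^ 18 ∧
      ∑ p, |klTransferWeight L M β μ K (n + 1) φ Qm p| ≤ 2 ^ 16 ∧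
      ∑ p, |b' p + klSliceWeightPlain L M β μ K (n + 1) Qm p - klSliceWeightSmeared L M β μ K (n + 1) φ Qm p| ≤ 2 ^ 16 + 2 ^ 19 := by
  have hw := sum_abs_klSliceWeightPlain_succ_le (M := M) β μ K hK hβ hβL n Qm
  have hw₁ := sum_abs_klSliceWeightSmeared_succ_le β μ K hK hβ hβL n hφ Qm
  have ht := sum_abs_klTransferWeight_le_of_frameOK hK hβ hβL (n + 1) hφ Qm
  refine ⟨?_, hw₁, ht, ?_⟩
  · calc ∑ p, |klSliceWeightPlain L M β μ K (n + 1) Qm p + b' p|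
        ≤ ∑ p, (|klSliceWeightPlain L M β μ K (n + 1) Qm p| + |b' p|) := sum_le_sum fun p _ => abs_add_le _ _
      _ ≤ 2 ^ 18 + 2 ^ 16 := by rw [sum_add_distrib]; exact add_le_add hw hb'
  · calc ∑ p, |b' p + klSliceWeightPlain L M β μ K (n + 1) Qm p - klSliceWeightSmeared L M β μ K (n + 1) φ Qm p|
        ≤ ∑ p, (|b' p| + |klSliceWeightPlain L M β μ K (n + 1) Qm p| + |klSliceWeightSmeared L M β μ K (n + 1) φ Qm p|) :=
          sum_le_sum fun p _ => (abs_sub _ _).trans (add_le_add (abs_add_le _ _) le_rfl)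
      _ ≤ 2 ^ 16 + 2 ^ 18 + 2 ^ 18 := by rw [sum_add_distrib, sum_add_distrib]; exact add_le_add (add_le_add hb' hw) hw₁
      _ = 2 ^ 16 + 2 ^ 19 := by norm_num

/-- **The four smallness conjuncts of `pairTransferPinnedAt_succ` for the MODEL WEIGHTS from ONE numeric door** `((3/2)m + e + e₁)·2^20 ≤ 1/3` (`0 ≤ m, e, e₁`;
history mass `Σ|b′| ≤ 2^16`). -/
theorem klModelWeights_smallness (hK : FrameOK R U N μ K) (hβ : klBetaMin ≤ β) (hβL : β ≤ L)
    (hφ : ∀ k, 0 ≤ φ k ∧ φ k ≤ 1 - hubbardCutoffWeightCT L M β μ K (klScale klE0 (n + 1)) k) (Qm : TorusSite 2 L)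
    {b' : TorusSite 2 L → ℝ} (hb' : ∑ p, |b' p| ≤ 2 ^ 16) {m e e₁ : ℝ} (hm : 0 ≤ m) (he : 0 ≤ e) (he₁ : 0 ≤ e₁)
    (hdoor : (3 / 2 * m + e + e₁) * 2 ^ 20 ≤ 1 / 3) :
    (m + e) * ∑ p, |klSliceWeightPlain L M β μ K (n + 1) Qm p + b' p| ≤ 1 / 3 ∧
      (3 / 2 * m + e₁) * ∑ p, |klSliceWeightSmeared L M β μ K (n + 1) φ Qm p| ≤ 1 / 3 ∧
      m * ∑ p, |b' p + klSliceWeightPlain L M β μ K (n + 1) Qm p - klSliceWeightSmeared L M β μ K (n + 1) φ Qm p| ≤ 1 / 3 ∧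
      m * ∑ p, |klTransferWeight L M β μ K (n + 1) φ Qm p| ≤ 1 / 3 := by
  obtain ⟨h1, h2, h3, h4⟩ := klModelWeights_masses hK hβ hβL hφ Qm hb'
  have hA : 0 ≤ 3 / 2 * m + e + e₁ := by positivity
  refine ⟨?_, ?_, ?_, ?_⟩
  · calc (m + e) * ∑ p, |klSliceWeightPlain L M β μ K (n + 1) Qm p + b' p| ≤ (3 / 2 * m + e + e₁) * (2 ^ 18 + 2 ^ 16) :=
          mul_le_mul (by linarith) h1 (sum_nonneg fun p _ => abs_nonneg _) hA
      _ ≤ (3 / 2 * m + e + e₁) * 2 ^ 20 := mul_le_mul_of_nonneg_left (by norm_num) hA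
      _ ≤ 1 / 3 := hdoor
  · calc (3 / 2 * m + e₁) * ∑ p, |klSliceWeightSmeared L M β μ K (n + 1) φ Qm p| ≤ (3 / 2 * m + e + e₁) * 2 ^ 18 :=
          mul_le_mul (by linarith) h2 (sum_nonneg fun p _ => abs_nonneg _) hA
      _ ≤ (3 / 2 * m + e + e₁) * 2 ^ 20 := mul_le_mul_of_nonneg_left (by norm_num) hA
      _ ≤ 1 / 3 := hdoor
  · calc m * ∑ p, |b' p + klSliceWeightPlain L M β μ K (n + 1) Qm p - klSliceWeightSmeared L M β μ K (n + 1) φ Qm p|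
        ≤ (3 / 2 * m + e + e₁) * (2 ^ 16 + 2 ^ 19) := mul_le_mul (by linarith) h4 (sum_nonneg fun p _ => abs_nonneg _) hA
      _ ≤ (3 / 2 * m + e + e₁) * 2 ^ 20 := mul_le_mul_of_nonneg_left (by norm_num) hA
      _ ≤ 1 / 3 := hdoor
  · calc m * ∑ p, |klTransferWeight L M β μ K (n + 1) φ Qm p| ≤ (3 / 2 * m + e + e₁) * 2 ^ 16 :=
          mul_le_mul (by linarith) h3 (sum_nonneg fun p _ => abs_nonneg _) hA
      _ ≤ (3 / 2 * m + e + e₁) * 2 ^ 20 := mul_le_mul_of_nonneg_left (by norm_num) hA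
      _ ≤ 1 / 3 := hdoor

/-- **With the model weights the slack is the FRAME SLACK of the history weight**: `Σ_p |(b′ + w − w₁) − t_{n+1}[φ]| ≤ Σ_p |b′ − t_n[φ + s_{n+1}]|` (all at one frame `K`). -/
theorem klModelWeights_slack_le (β μ : ℝ) (K : TrigPolyC4v) (n : ℕ) (φ : FreqMomentum L M → ℝ) (b' : TorusSite 2 L → ℝ) (Qm : TorusSite 2 L) :
    ∑ p, |(b' p + klSliceWeightPlain L M β μ K (n + 1) Qm p - klSliceWeightSmeared L M β μ K (n + 1) φ Qm p) -
        klTransferWeight L M β μ K (n + 1) φ Qm p| ≤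
      ∑ p, |b' p - klTransferWeight L M β μ K n (φ + softSymbolCompl L M β μ K n (n + 1)) Qm p| := by
  refine (sum_abs_composite_sub_klTransferWeight_succ_le β μ K n φ b' _ _ Qm).trans (le_of_eq ?_)
  simp only [sub_self, abs_zero, sum_const_zero, add_zero]

end Smallness

/-! ## §2 The door with the model weights -/

section Door

variable (L M : ℕ) [NeZero L] [NeZero M]

/-- **`pairTransferPinnedAt_succ_model` — the class-#5 producer door with `w, w₁` THE MODEL WEIGHTS.**  Frame `K′ := klFlowFrameU … (n+1)`; `|C₁| ≤ m`; `φ` admissible at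
`(K′, n+1)`; `FrameOK R U N μ K′`, `klBetaMin ≤ β ≤ L`.  Per pair class `Qm` at resolution `n+1` the caller supplies: `X, Y, N₀, M′, N`; a history weight `b′` with `Σ|b′| ≤ 2^16`;
the plain step with weight `klSliceWeightPlain … K′ (n+1) Qm` (`E ≤ e`), the history straddle (`b′, M′, R′`), the member tower with weight `klSliceWeightSmeared … K′ (n+1) φ Qm` (`E_a`);
`E₁ ≥ R′ + FT(E)`, `E₁ ≤ e₁`; the numeric door `((3/2)m + e + e₁)·2^20 ≤ 1/3`; and the budget with the frame slack `E_a + FT_{|w₁|}(E₁) + (9/4)m²·Σ|b′ − t_n[φ + s_{n+1}]| ≤ transferBarAt … (n+1)`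
⟹ `PairTransferPinnedAt L M G P r β U μ (n+1) φ`. -/
theorem pairTransferPinnedAt_succ_model {G : GeoConsts} {P : SplitConsts} {R : RenConsts} {N : ℕ} {r β U μ : ℝ} {n : ℕ} {m : ℝ} (hm : 0 ≤ m)
    {φ : FreqMomentum L M → ℝ} (hK : FrameOK R U N μ (klFlowFrameU L M β U μ (n + 1))) (hβ : klBetaMin ≤ β) (hβL : β ≤ L)
    (hφ : IsSoftSymbol L M β μ (klFlowFrameU L M β U μ (n + 1)) (n + 1) φ)
    (hC₁ : ∀ Qm s t, ‖klPairArrayF L M β U μ (n + 1) Qm s t‖ ≤ m)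
    (hdata : ∀ Qm : TorusSite 2 L, IsPairClassAt L Qm (n + 1) →
      ∃ (X Y N₀ M' N : Matrix (TorusSite 2 L) (TorusSite 2 L) ℂ) (b' : TorusSite 2 L → ℝ)
        (E R' Ea E₁ : TorusSite 2 L → TorusSite 2 L → ℝ) (e e₁ : ℝ),
        0 ≤ e ∧ 0 ≤ e₁ ∧ (∑ p, |b' p| ≤ 2 ^ 16) ∧ (3 / 2 * m + e + e₁) * 2 ^ 20 ≤ 1 / 3 ∧
        (∀ x y, ¬(x ∈ klBall L μ 0 ∧ y ∈ klBall L μ 0) → X x y = 0) ∧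
        (∀ x y, ¬(x ∈ klBall L μ 0 ∧ y ∈ klBall L μ 0) → Y x y = 0) ∧
        (∀ k ∈ klBall L μ 0, ∀ k' ∈ klBall L μ 0,
          Y k k' = klCovSmearedPairAmplitude L M β U μ (klFlowFrameU L M β U μ (n + 1)) (n + 1)
            (softCovOf L M β μ (klFlowFrameU L M β U μ (n + 1)) φ) Qm k k') ∧
        (∀ x y, 0 ≤ E x y) ∧ (∀ x y, 0 ≤ R' x y) ∧ (∀ x y, 0 ≤ Ea x y) ∧
        (1 + diagonal (fun p => (klSliceWeightPlain L M β μ (klFlowFrameU L M β U μ (n + 1)) (n + 1) Qm p : ℂ)) *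
            klPairArrayF L M β U μ n Qm) * N₀ = 1 ∧
        (∀ k ∈ klBall L μ 0, ∀ k' ∈ klBall L μ 0,
          ‖klPairAmplitude L M β U μ (klFlowFrameU L M β U μ (n + 1)) (n + 1) Qm k k' - (klPairArrayF L M β U μ n Qm * N₀) k k'‖ ≤ E k k') ∧
        (∀ x y, E x y ≤ e) ∧
        (1 - diagonal (fun p => (b' p : ℂ)) * klPairArrayF L M β U μ n Qm) * M' = 1 ∧
        (∀ k ∈ klBall L μ 0, ∀ k' ∈ klBall L μ 0, ‖X k k' - (klPairArrayF L M β U μ n Qm * M') k k'‖ ≤ R' k k') ∧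
        (1 + diagonal (fun p => (klSliceWeightSmeared L M β μ (klFlowFrameU L M β U μ (n + 1)) (n + 1) φ Qm p : ℂ)) * X) * N = 1 ∧
        (∀ k ∈ klBall L μ 0, ∀ k' ∈ klBall L μ 0, ‖Y k k' - (X * N) k k'‖ ≤ Ea k k') ∧
        (∀ x y, R' x y + (E x y +
            3 / 2 * m * ∑ t, E x t * |klSliceWeightPlain L M β μ (klFlowFrameU L M β U μ (n + 1)) (n + 1) Qm t + b' t| +
            3 / 2 * (m + e) * ∑ a, |klSliceWeightPlain L M β μ (klFlowFrameU L M β U μ (n + 1)) (n + 1) Qm a + b' a| * E a y +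
            9 / 4 * (m + e) * m * ∑ a, ∑ t, |klSliceWeightPlain L M β μ (klFlowFrameU L M β U μ (n + 1)) (n + 1) Qm a + b' a| * E a t *
              |klSliceWeightPlain L M β μ (klFlowFrameU L M β U μ (n + 1)) (n + 1) Qm t + b' t|) ≤ E₁ x y) ∧
        (∀ x y, E₁ x y ≤ e₁) ∧
        (∀ k ∈ klBall L μ 0, ∀ k' ∈ klBall L μ 0,
          Ea k k' + (E₁ k k' +
              3 / 2 * (3 / 2 * m) * ∑ t, E₁ k t * |klSliceWeightSmeared L M β μ (klFlowFrameU L M β U μ (n + 1)) (n + 1) φ Qm t| +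
              3 / 2 * (3 / 2 * m + e₁) * ∑ a, |klSliceWeightSmeared L M β μ (klFlowFrameU L M β U μ (n + 1)) (n + 1) φ Qm a| * E₁ a k' +
              9 / 4 * (3 / 2 * m + e₁) * (3 / 2 * m) * ∑ a, ∑ t, |klSliceWeightSmeared L M β μ (klFlowFrameU L M β U μ (n + 1)) (n + 1) φ Qm a| *
                E₁ a t * |klSliceWeightSmeared L M β μ (klFlowFrameU L M β U μ (n + 1)) (n + 1) φ Qm t|) +
            9 / 4 * m ^ 2 * ∑ p, |b' p - klTransferWeight L M β μ (klFlowFrameU L M β U μ (n + 1)) n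
              (φ + softSymbolCompl L M β μ (klFlowFrameU L M β U μ (n + 1)) n (n + 1)) Qm p| ≤
            transferBarAt L G P r β U (n + 1) Qm k k')) :
    PairTransferPinnedAt L M G P r β U μ (n + 1) φ := by
  refine pairTransferPinnedAt_succ L M hm hC₁ fun Qm hQm => ?_
  obtain ⟨X, Y, N₀, M', N, b', E, R', Ea, E₁, e, e₁, he, he₁, hb', hdoor, hX0, hY0, hYeq, hE0, hR'0, hEa0, hN₀, hE, hEe, hM', hR', hN, hEa,
    hE₁, hE₁e, hbud⟩ := hdata Qm hQm
  obtain ⟨hs1, hs2, hs4, hs5⟩ := klModelWeights_smallness hK hβ hβL hφ.1 Qm hb' hm he he₁ hdoor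
  refine ⟨X, Y, N₀, M', N, fun p => klSliceWeightPlain L M β μ (klFlowFrameU L M β U μ (n + 1)) (n + 1) Qm p, b',
    fun p => klSliceWeightSmeared L M β μ (klFlowFrameU L M β U μ (n + 1)) (n + 1) φ Qm p, E, R', Ea, E₁, e, e₁,
    ∑ p, |b' p - klTransferWeight L M β μ (klFlowFrameU L M β U μ (n + 1)) n
      (φ + softSymbolCompl L M β μ (klFlowFrameU L M β U μ (n + 1)) n (n + 1)) Qm p|,
    he, he₁, hX0, hY0, hYeq, hE0, hR'0, hEa0, hN₀, hE, hEe, hM', hR', hN, hEa, hE₁, hE₁e, hs1, hs2,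
    klModelWeights_slack_le β μ _ n φ b' Qm, hs4, hs5, hbud⟩

end Door

end Summit.HubbardSuperconductivity.HubbardSuperconductivity.Theorems.KLRegimeSplit

end
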